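import Mathlib.FieldTheory.Galois.Basic
import Mathlib.LinearAlgebra.Lagrange
import Mathlib.Algebra.Polynomial.Lifts
import Literature.AlgebraicGeometry.Motives.MumfordTateInvariantsTorusNorm
import HarnessLib

/-!
# Rational points of the torus through a semisimple element: descent to `ℚ[X]` (Mumford–Tate invariants, step 8)

Continuation of `MumfordTateInvariantsTorusNorm.lean`. A Galois-equivariant family of values on
the roots of `p ∈ ℚ[X]` in its splitting field `L` is interpolated by a polynomial with RATIONAL
coefficients (`exists_polynomial_of_gal_equivariant`: the Lagrange interpolant is Galois-fixed,
and `L^{Gal} = ℚ`). Applied to the norm points this gives the main result of the two files,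
transported to any field `E` in which `p` splits (e.g. `E = ℂ`):

`exists_polynomial_torusPoint`: for a separable `p ∈ ℚ[X]` splitting in `E` with roots `R ⊆ E`
and finitely many weight vectors `M : R → ℤ` with `Σ M(μ) μ ≠ 0`, there is `P₀ ∈ ℚ[X]` whose
values `U(μ) = P₀(μ)` on the roots are non-zero, satisfy `∏ U(μ)^{M(μ)} = 1` for EVERY `M` with
`Σ M(μ) μ = 0`, and `∏ U(μ)^{M(μ)} ≠ 1` for the given `M`'s.

For `p` the minimal polynomial of a semisimple `S ∈ End_ℚ V`, `u = P₀(S)` is then a RATIONAL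
element of the algebraic torus `𝒜(S)` through `S` (it satisfies all the multiplicative relations
among eigenvalues forced by the additive ones) which nevertheless separates prescribed eigenvalue
configurations of `S` — the explicit substitute, in the proof of
`Deligne1982_mumfordTateInvariants`, for the Zariski density of the rational points of a connected
`ℚ`-group (Borel, *Linear Algebraic Groups*, 7.3, 8.13–8.14, 18.2–18.3).

## References

* A. Borel, *Linear Algebraic Groups*, 2nd ed., GTM 126 (1991), §7.3, 8.13–8.14, 18.2–18.3.
-/

noncomputable section

open Polynomial

namespace Literature.AlgebraicGeometry.Motives

universe u v

variable {F : Type u} [Field F] {p : F[X]}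

/-! ### Galois-equivariant families of values on the roots are rational polynomials -/

/-- **Descent.** Let `p` be separable, so that its splitting field `L` is Galois over `ℚ`. A family
of values `f μ ∈ L` on the roots `μ` of `p` which is Galois-equivariant (`σ (f μ) = f (σ μ)`) is
interpolated by a polynomial with rational coefficients: `f μ = P₀(μ)`. (Lagrange interpolation;
the interpolant is fixed by `Gal(L/ℚ)` coefficientwise, and `L^{Gal} = ℚ`.) [folklore] -/
theorem exists_polynomial_of_gal_equivariant (hp : p.Separable)
    (f : p.rootSet p.SplittingField → p.SplittingField)
    (hf : ∀ (σ : p.Gal) (μ : p.rootSet p.SplittingField), σ (f μ) = f (σ • μ)) :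
    ∃ P₀ : F[X], ∀ μ : p.rootSet p.SplittingField, aeval (μ : p.SplittingField) P₀ = f μ := by
  classical
  haveI : IsGalois F p.SplittingField := IsGalois.of_separable_splitting_field hp
  have hvs : Set.InjOn (Subtype.val : p.rootSet p.SplittingField → p.SplittingField)
      (Finset.univ : Finset (p.rootSet p.SplittingField)) := Subtype.val_injective.injOn
  set P : (p.SplittingField)[X] := Lagrange.interpolate Finset.univ Subtype.val f with hP
  have hPeval : ∀ μ : p.rootSet p.SplittingField, P.eval (μ : p.SplittingField) = f μ := fun μ =>
    Lagrange.eval_interpolate_at_node f hvs (Finset.mem_univ μ)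
  have hPdeg : P.degree < (Finset.univ : Finset (p.rootSet p.SplittingField)).card :=
    Lagrange.degree_interpolate_lt f hvs
  -- `P` is Galois-fixed
  have hPfix : ∀ σ : p.Gal, P.map (σ : p.SplittingField →+* p.SplittingField) = P := by
    intro σ
    have hdeg : (P.map (σ : p.SplittingField →+* p.SplittingField)).degree <
        (Finset.univ : Finset (p.rootSet p.SplittingField)).card := by
      rwa [degree_map_eq_of_injective (RingHom.injective _)]
    rw [hP] at hdeg ⊢
    refine Lagrange.eq_interpolate_of_eval_eq f hvs hdeg fun μ _ => ?_
    have h1 : (μ : p.SplittingField) = (σ : p.SplittingField →+* p.SplittingField)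
        ((σ⁻¹ • μ : p.rootSet p.SplittingField) : p.SplittingField) :=
      (σ.apply_symm_apply _).symm
    rw [h1, eval_map, eval₂_hom, ← hP]
    change σ (P.eval _) = f μ
    rw [hPeval, hf, smul_inv_smul]
  -- hence its coefficients are rational
  have hcoeff : ∀ k, P.coeff k ∈ Set.range (algebraMap F p.SplittingField) := by
    intro k
    rw [IsGalois.mem_range_algebraMap_iff_fixed]
    intro σ
    have h := congrArg (fun Q : (p.SplittingField)[X] => Q.coeff k) (hPfix σ)
    simp only [coeff_map] at h
    exact h
  obtain ⟨P₀, hP₀⟩ := (mem_lifts P).1 ((lifts_iff_coeff_lifts P).2 hcoeff)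
  refine ⟨P₀, fun μ => ?_⟩
  rw [aeval_def, ← eval_map, hP₀, hPeval]

/-! ### The main statement, over the splitting field and over any splitting extension -/

/-- **Rational torus points separating root configurations (splitting-field version).** For a
separable `p` and finitely many weight vectors `M` on the roots of `p` in its splitting field with
`Σ M(μ) μ ≠ 0`, there is `P₀ ∈ ℚ[X]` with non-zero values `U(μ) = P₀(μ)` on the roots such that
`∏ U(μ)^{M(μ)} = 1` whenever `Σ M(μ) μ = 0`, and `≠ 1` for the given `M`'s. [folklore] -/
theorem exists_polynomial_torusPoint_splittingField [CharZero F] (hp : p.Separable)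
    (𝓜 : Finset (p.rootSet p.SplittingField → ℤ))
    (h𝓜 : ∀ M ∈ 𝓜, ∑ μ : p.rootSet p.SplittingField, M μ • (μ : p.SplittingField) ≠ 0) :
    ∃ P₀ : F[X],
      (∀ μ : p.rootSet p.SplittingField, aeval (μ : p.SplittingField) P₀ ≠ 0) ∧
      (∀ M : p.rootSet p.SplittingField → ℤ,
        ∑ μ : p.rootSet p.SplittingField, M μ • (μ : p.SplittingField) = 0 →
          ∏ μ : p.rootSet p.SplittingField, aeval (μ : p.SplittingField) P₀ ^ M μ = 1) ∧
      ∀ M ∈ 𝓜, ∏ μ : p.rootSet p.SplittingField, aeval (μ : p.SplittingField) P₀ ^ M μ ≠ 1 := by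
  obtain ⟨ν, φ, c, hν, hc, hsep⟩ := exists_normPoint_family 𝓜 h𝓜
  obtain ⟨P₀, hP₀⟩ := exists_polynomial_of_gal_equivariant hp (normPoint ν c)
    (gal_apply_normPoint ν c)
  refine ⟨P₀, fun μ => ?_, fun M hM => ?_, fun M hM => ?_⟩
  · rw [hP₀]
    exact normPoint_ne_zero ν hc μ
  · simp_rw [hP₀]
    exact prod_normPoint_zpow_eq_one ν φ hν hc M hM
  · simp_rw [hP₀]
    exact hsep M hM

section Transport

variable {E : Type v} [Field E] [Algebra F E]

/-- **Rational torus points separating root configurations.** Let `p ∈ ℚ[X]` be separable and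
split in the field `E` (e.g. `E = ℂ`), with roots `R ⊆ E`, and let finitely many weight vectors
`M : R → ℤ` with `Σ M(μ) μ ≠ 0` be given. Then there is `P₀ ∈ ℚ[X]` such that the values
`U(μ) = P₀(μ)` (`μ ∈ R`) are non-zero, satisfy `∏ U(μ)^{M(μ)} = 1` for EVERY weight vector `M`
with `Σ M(μ) μ = 0`, and `∏ U(μ)^{M(μ)} ≠ 1` for each given `M`. For `p` the minimal polynomial
of a semisimple `S ∈ End_ℚ V` these are rational points `P₀(S)` of the torus through `S`
(Borel, *Linear Algebraic Groups*, 7.3, 8.13–8.14) separating prescribed eigenvalue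
configurations: the explicit density statement used for the semisimple directions of the
Mumford–Tate group. [folklore] -/
theorem exists_polynomial_torusPoint [CharZero F] (hp : p.Separable) (hE : (p.map (algebraMap F E)).Splits)
    (𝓜 : Finset (p.rootSet E → ℤ)) (h𝓜 : ∀ M ∈ 𝓜, ∑ μ : p.rootSet E, M μ • (μ : E) ≠ 0) :
    ∃ P₀ : F[X],
      (∀ μ : p.rootSet E, aeval (μ : E) P₀ ≠ 0) ∧
      (∀ M : p.rootSet E → ℤ, ∑ μ : p.rootSet E, M μ • (μ : E) = 0 →
        ∏ μ : p.rootSet E, aeval (μ : E) P₀ ^ M μ = 1) ∧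
      ∀ M ∈ 𝓜, ∏ μ : p.rootSet E, aeval (μ : E) P₀ ^ M μ ≠ 1 := by
  classical
  haveI : Fact ((p.map (algebraMap F E)).Splits) := ⟨hE⟩
  -- Mathlib's bijection `rootSet p p.SplittingField ≃ rootSet p E` along the embedding `j`
  set ρ := Polynomial.Gal.rootsEquivRoots p E with hρ
  set j : p.SplittingField →ₐ[F] E := IsScalarTower.toAlgHom F p.SplittingField E with hj
  have hcoe : ∀ μ' : p.rootSet p.SplittingField, ((ρ μ' : p.rootSet E) : E) = j μ' := fun _ => rfl
  -- transport of weighted root sums and of products along `j`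
  have hsum : ∀ M : p.rootSet E → ℤ,
      ∑ μ : p.rootSet E, M μ • (μ : E) =
        j (∑ μ' : p.rootSet p.SplittingField, (M ∘ ρ) μ' • (μ' : p.SplittingField)) := by
    intro M
    rw [map_sum, ← Fintype.sum_equiv ρ (fun μ' => j ((M ∘ ρ) μ' • (μ' : p.SplittingField)))
      (fun μ => M μ • (μ : E)) fun μ' => ?_]
    rw [map_zsmul, Function.comp_apply, hcoe]
  have hprod : ∀ (P₀ : F[X]) (M : p.rootSet E → ℤ),
      ∏ μ : p.rootSet E, aeval (μ : E) P₀ ^ M μ =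
        j (∏ μ' : p.rootSet p.SplittingField, aeval (μ' : p.SplittingField) P₀ ^ (M ∘ ρ) μ') := by
    intro P₀ M
    rw [map_prod, ← Fintype.prod_equiv ρ
      (fun μ' => j (aeval (μ' : p.SplittingField) P₀ ^ (M ∘ ρ) μ')) (fun μ => aeval (μ : E) P₀ ^ M μ)
      fun μ' => ?_]
    rw [map_zpow₀, Function.comp_apply, hcoe, aeval_algHom_apply]
  obtain ⟨P₀, h0, hrel, hsep⟩ := exists_polynomial_torusPoint_splittingField hp
    (𝓜.image fun M => M ∘ ρ) (by
      intro M' hM'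
      obtain ⟨M, hM, rfl⟩ := Finset.mem_image.1 hM'
      intro h0
      apply h𝓜 M hM
      rw [hsum, h0, map_zero])
  refine ⟨P₀, fun μ => ?_, fun M hM => ?_, fun M hM => ?_⟩
  · obtain ⟨μ', rfl⟩ := ρ.surjective μ
    rw [hcoe, aeval_algHom_apply, _root_.map_ne_zero]
    exact h0 μ'
  · rw [hprod, hrel (M ∘ ρ) ?_, map_one]
    have h := hsum M
    rw [hM] at h
    exact j.injective (h.symm.trans (map_zero j).symm)
  · rw [hprod]
    intro h1
    exact hsep _ (Finset.mem_image_of_mem _ hM) (j.injective (h1.trans (map_one j).symm))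

end Transport

end Literature.AlgebraicGeometry.Motives

end
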